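import Literature.NumberTheory.LFunctions.DirichletLTruncationCertificatesOdd
import Literature.NumberTheory.LFunctions.DirichletLTruncationCertificatesMean
import Literature.NumberTheory.LFunctions.NoRealZeroOddTruncationModulus1012
import HarnessLib

/-!
# No real zero for the ODD real primitive characters of conductor `1001 ≤ q ≤ 1050`, in the kernel
# (truncation certificates with drift)

Topic `Literature/NumberTheory/LFunctions`; namespace `Literature.NumberTheory.LFunctions`
(private per-modulus work in `Literature.NumberTheory.LFunctions.OddTruncationVa`). THEOREMS only (no
definition, no named fact, no `sorry`): **`noRealZeroOdd_range_1001_1050`** — for every modulus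
`1001 ≤ q ≤ 1050`, every primitive quadratic ODD `χ` mod `q` (imaginary quadratic fields of discriminant `−q`)
and every `σ ∈ (0, 1)`, `L(σ, χ) ≠ 0`.

Per modulus (one bullet each, in the order of `interval_cases`): moduli without a primitive quadratic
character are dismissed (`q ≡ 2 (mod 4)`, `16 ∣ q`, `p² ∣ q` — MV Thm 9.13); the EVEN primitive quadratic
character is excluded by the parity test inside `LTruncationCert.good_odd_of_*`; the ODD one is certified by
**`LTruncationCert.certDriftOK v q K J P`** (`DirichletLTruncationCertificatesOdd.lean`): the truncation
`∑_{n ≤ Kq} χ(n) n^{−σ}` after `K` periods dominates the one-sided second-order tail bound `B⁻/(2(Kq+1)^{3/2})`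
(`B⁻ = max_N (−U(N))⁺`; the drift `U(q) = q·h(−q) > 0` only helps) on each of `J` cells covering `[1/2, 1]`,
and the functional equation reflects `(0, 1/2)` to `(1/2, 1)`.  16 certificates in this file (parameters
and margins in the docstrings; `K > 1` / `J > 16` only where the one-period truncation is too small at
`σ = 1/2`). [cite: Chua2005RealZeros, §2.2 ALGO 1]

## References

* K. S. Chua, *Real zeros of Dedekind zeta functions of real quadratic fields*, Math. Comp. 74 (2005)
  1457–1470, §2. [Chua2005RealZeros]
* M. Watkins, *Real zeros of real odd Dirichlet L-functions*, Math. Comp. 73 (2004) 415–423.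
  [Watkins2004RealZeros]
* H. L. Montgomery, R. C. Vaughan, *Multiplicative Number Theory I*, CUP 2007, §9.3 Thm 9.13, §10.1.
  [MontgomeryVaughan2007]
-/

namespace Literature.NumberTheory.LFunctions

namespace OddTruncationVa

open FeketePolyaKernel PrimitiveQuadratic LTruncationCert

/-- Conductor `≡ 2 (mod 4)`: no primitive character (private copy of the sweep-4 lemma).
[cite: MontgomeryVaughan2007, §9.3 Theorem 9.13] -/
private theorem absurd_of_mod_four_two {q : ℕ} [NeZero q] (hq : q % 4 = 2)
    {χ : DirichletCharacter ℂ q} (hprim : χ.IsPrimitive) : False := by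
  obtain ⟨m, rfl⟩ : ∃ m, q = 2 * m := ⟨q / 2, by omega⟩
  haveI : NeZero m := ⟨by omega⟩
  exact not_isPrimitive_two_mul (m := m) (Nat.odd_iff.mpr (by omega)) hprim

/-- Conductor divisible by `16`: no primitive quadratic character (private copy).
[cite: MontgomeryVaughan2007, §9.3 Theorem 9.13] -/
private theorem absurd_of_sixteen_dvd {q : ℕ} [NeZero q] (hq : q % 16 = 0) {χ : DirichletCharacter ℂ q}
    (hprim : χ.IsPrimitive) (hquad : χ.IsQuadratic) : False := by
  obtain ⟨k, m, hm, rfl⟩ := Nat.exists_eq_two_pow_mul_odd (NeZero.ne q)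
  have hm2 := Nat.odd_iff.mp hm
  haveI : NeZero m := ⟨by omega⟩
  have hk := le_three_of_level_two_pow_mul hm hprim hquad
  interval_cases k <;> norm_num at hq <;> omega

/-- Conductor with an odd square factor `p²`: no primitive quadratic character (private copy).
[cite: MontgomeryVaughan2007, §9.3 Theorem 9.13] -/
private theorem absurd_of_sq_dvd {q : ℕ} [NeZero q] {p : ℕ} (hp : p.Prime) (hp2 : p ≠ 2)
    (hpq : p * p ∣ q) {χ : DirichletCharacter ℂ q} (hprim : χ.IsPrimitive) (hquad : χ.IsQuadratic) :
    False := by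
  obtain ⟨k, m, hm, rfl⟩ := Nat.exists_eq_two_pow_mul_odd (NeZero.ne q)
  have hm2 := Nat.odd_iff.mp hm
  haveI : NeZero m := ⟨by omega⟩
  have hsq := squarefree_of_level_two_pow_mul hm hprim hquad
  have hp2' : Nat.Coprime p 2 := (Nat.coprime_primes hp Nat.prime_two).mpr hp2
  have hcop : Nat.Coprime (p * p) (2 ^ k) := Nat.Coprime.pow_right k (Nat.Coprime.mul_left hp2' hp2')
  have hpm : p * p ∣ m := hcop.dvd_of_dvd_mul_left hpq
  exact hp.one_lt.ne' (Nat.isUnit_iff.mp (hsq p hpm))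

/-- `1003`: the odd character `(·/1003)` = `χ_{−1003}` — drift certificate `K = 1`, `J = 16`, `P = 32` (`B⁻ = 760`, worst cell margin `0.227`). [cite: Chua2005RealZeros, §2.2 ALGO 1] -/
private theorem goodOdd1003 :
    ∀ χ : DirichletCharacter ℂ 1003, χ.IsQuadratic → χ.IsPrimitive → χ.Odd →
      ∀ σ : ℝ, 0 < σ → σ < 1 → χ.LFunction σ ≠ 0 :=
  good_odd_of_odd (by decide) (by decide) 1 16 32 (by decide +kernel)

/-- `1007`: the odd character `(·/1007)` = `χ_{−1007}` — drift certificate `K = 1`, `J = 16`, `P = 32` (`B⁻ = 0`, worst cell margin `2.462`). [cite: Chua2005RealZeros, §2.2 ALGO 1] -/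
private theorem goodOdd1007 :
    ∀ χ : DirichletCharacter ℂ 1007, χ.IsQuadratic → χ.IsPrimitive → χ.Odd →
      ∀ σ : ℝ, 0 < σ → σ < 1 → χ.LFunction σ ≠ 0 :=
  good_odd_of_odd (by decide) (by decide) 1 16 32 (by decide +kernel)

/-- `1011`: the odd character `(·/1011)` = `χ_{−1011}` — drift certificate `K = 1`, `J = 16`, `P = 32` (`B⁻ = 0`, worst cell margin `0.973`). [cite: Chua2005RealZeros, §2.2 ALGO 1] -/
private theorem goodOdd1011 :
    ∀ χ : DirichletCharacter ℂ 1011, χ.IsQuadratic → χ.IsPrimitive → χ.Odd →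
      ∀ σ : ℝ, 0 < σ → σ < 1 → χ.LFunction σ ≠ 0 :=
  good_odd_of_odd (by decide) (by decide) 1 16 32 (by decide +kernel)

/-- `1015`: the odd character `(·/1015)` = `χ_{−1015}` — drift certificate `K = 1`, `J = 16`, `P = 32` (`B⁻ = 0`, worst cell margin `1.284`). [cite: Chua2005RealZeros, §2.2 ALGO 1] -/
private theorem goodOdd1015 :
    ∀ χ : DirichletCharacter ℂ 1015, χ.IsQuadratic → χ.IsPrimitive → χ.Odd →
      ∀ σ : ℝ, 0 < σ → σ < 1 → χ.LFunction σ ≠ 0 :=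
  good_odd_of_odd (by decide) (by decide) 1 16 32 (by decide +kernel)

/-- `1016 = 8·127`: the odd character `χ₈·(·/127)` = `χ_{−1016}` — drift certificate `K = 1`, `J = 16`, `P = 32` (`B⁻ = 0`, worst cell margin `1.286`); the other primitive quadratic character mod `1016` is even (parity test). [cite: Chua2005RealZeros, §2.2 ALGO 1] -/
private theorem goodOdd1016 :
    ∀ χ : DirichletCharacter ℂ 1016, χ.IsQuadratic → χ.IsPrimitive → χ.Odd →
      ∀ σ : ℝ, 0 < σ → σ < 1 → χ.LFunction σ ≠ 0 :=
  good_odd_of_eight (by decide) (by decide) 1 16 32 (by decide +kernel) (by decide +kernel)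

/-- `1019`: the odd character `(·/1019)` = `χ_{−1019}` — drift certificate `K = 1`, `J = 16`, `P = 32` (`B⁻ = 0`, worst cell margin `1.048`). [cite: Chua2005RealZeros, §2.2 ALGO 1] -/
private theorem goodOdd1019 :
    ∀ χ : DirichletCharacter ℂ 1019, χ.IsQuadratic → χ.IsPrimitive → χ.Odd →
      ∀ σ : ℝ, 0 < σ → σ < 1 → χ.LFunction σ ≠ 0 :=
  good_odd_of_odd (by decide) (by decide) 1 16 32 (by decide +kernel)

/-- `1023`: the odd character `(·/1023)` = `χ_{−1023}` — drift certificate `K = 1`, `J = 16`, `P = 32` (`B⁻ = 0`, worst cell margin `1.272`). [cite: Chua2005RealZeros, §2.2 ALGO 1] -/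
private theorem goodOdd1023 :
    ∀ χ : DirichletCharacter ℂ 1023, χ.IsQuadratic → χ.IsPrimitive → χ.Odd →
      ∀ σ : ℝ, 0 < σ → σ < 1 → χ.LFunction σ ≠ 0 :=
  good_odd_of_odd (by decide) (by decide) 1 16 32 (by decide +kernel)

/-- `1027`: the odd character `(·/1027)` = `χ_{−1027}` — drift certificate `K = 1`, `J = 16`, `P = 32` (`B⁻ = 752`, worst cell margin `0.155`). [cite: Chua2005RealZeros, §2.2 ALGO 1] -/
private theorem goodOdd1027 :
    ∀ χ : DirichletCharacter ℂ 1027, χ.IsQuadratic → χ.IsPrimitive → χ.Odd →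
      ∀ σ : ℝ, 0 < σ → σ < 1 → χ.LFunction σ ≠ 0 :=
  good_odd_of_odd (by decide) (by decide) 1 16 32 (by decide +kernel)

/-- `1028 = 4·257`: the odd character `χ₋₄·(·/257)` = `χ_{−1028}` — drift certificate `K = 1`, `J = 16`, `P = 32` (`B⁻ = 0`, worst cell margin `1.282`). [cite: Chua2005RealZeros, §2.2 ALGO 1] -/
private theorem goodOdd1028 :
    ∀ χ : DirichletCharacter ℂ 1028, χ.IsQuadratic → χ.IsPrimitive → χ.Odd →
      ∀ σ : ℝ, 0 < σ → σ < 1 → χ.LFunction σ ≠ 0 :=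
  good_odd_of_four (by decide) (by decide) 1 16 32 (by decide +kernel)

/-- `1031`: the odd character `(·/1031)` = `χ_{−1031}` — drift certificate `K = 1`, `J = 16`, `P = 32` (`B⁻ = 0`, worst cell margin `2.847`). [cite: Chua2005RealZeros, §2.2 ALGO 1] -/
private theorem goodOdd1031 :
    ∀ χ : DirichletCharacter ℂ 1031, χ.IsQuadratic → χ.IsPrimitive → χ.Odd →
      ∀ σ : ℝ, 0 < σ → σ < 1 → χ.LFunction σ ≠ 0 :=
  good_odd_of_odd (by decide) (by decide) 1 16 32 (by decide +kernel)

/-- `1032 = 8·129`: the odd character `χ₋₈·(·/129)` = `χ_{−1032}` — drift certificate `K = 1`, `J = 16`, `P = 32` (`B⁻ = 216`, worst cell margin `0.564`); the other primitive quadratic character mod `1032` is even (parity test). [cite: Chua2005RealZeros, §2.2 ALGO 1] -/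
private theorem goodOdd1032 :
    ∀ χ : DirichletCharacter ℂ 1032, χ.IsQuadratic → χ.IsPrimitive → χ.Odd →
      ∀ σ : ℝ, 0 < σ → σ < 1 → χ.LFunction σ ≠ 0 :=
  good_odd_of_eight (by decide) (by decide) 1 16 32 (by decide +kernel) (by decide +kernel)

/-- `1039`: the odd character `(·/1039)` = `χ_{−1039}` — drift certificate `K = 1`, `J = 16`, `P = 32` (`B⁻ = 0`, worst cell margin `1.850`). [cite: Chua2005RealZeros, §2.2 ALGO 1] -/
private theorem goodOdd1039 :
    ∀ χ : DirichletCharacter ℂ 1039, χ.IsQuadratic → χ.IsPrimitive → χ.Odd →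
      ∀ σ : ℝ, 0 < σ → σ < 1 → χ.LFunction σ ≠ 0 :=
  good_odd_of_odd (by decide) (by decide) 1 16 32 (by decide +kernel)

/-- `1043`: the odd character `(·/1043)` = `χ_{−1043}` — drift certificate `K = 1`, `J = 16`, `P = 32` (`B⁻ = 61`, worst cell margin `0.619`). [cite: Chua2005RealZeros, §2.2 ALGO 1] -/
private theorem goodOdd1043 :
    ∀ χ : DirichletCharacter ℂ 1043, χ.IsQuadratic → χ.IsPrimitive → χ.Odd →
      ∀ σ : ℝ, 0 < σ → σ < 1 → χ.LFunction σ ≠ 0 :=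
  good_odd_of_odd (by decide) (by decide) 1 16 32 (by decide +kernel)

/-- `1047`: the odd character `(·/1047)` = `χ_{−1047}` — drift certificate `K = 1`, `J = 16`, `P = 32` (`B⁻ = 0`, worst cell margin `1.255`). [cite: Chua2005RealZeros, §2.2 ALGO 1] -/
private theorem goodOdd1047 :
    ∀ χ : DirichletCharacter ℂ 1047, χ.IsQuadratic → χ.IsPrimitive → χ.Odd →
      ∀ σ : ℝ, 0 < σ → σ < 1 → χ.LFunction σ ≠ 0 :=
  good_odd_of_odd (by decide) (by decide) 1 16 32 (by decide +kernel)

/-- `1048 = 8·131`: the odd character `χ₈·(·/131)` = `χ_{−1048}` — drift certificate `K = 1`, `J = 16`, `P = 32` (`B⁻ = 548`, worst cell margin `0.324`); the other primitive quadratic character mod `1048` is even (parity test). [cite: Chua2005RealZeros, §2.2 ALGO 1] -/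
private theorem goodOdd1048 :
    ∀ χ : DirichletCharacter ℂ 1048, χ.IsQuadratic → χ.IsPrimitive → χ.Odd →
      ∀ σ : ℝ, 0 < σ → σ < 1 → χ.LFunction σ ≠ 0 :=
  good_odd_of_eight (by decide) (by decide) 1 16 32 (by decide +kernel) (by decide +kernel)

/-- **No real zero in `(0, 1)` for every odd real primitive character of conductor `1001 ≤ q ≤ 1050`**
(one bullet per modulus, in the order of `interval_cases`). [cite: Chua2005RealZeros, §2.2 ALGO 1] -/
theorem range_1001_1050 (q : ℕ) [NeZero q] (hlo : 1000 < q) (hhi : q ≤ 1050) :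
    ∀ χ : DirichletCharacter ℂ q, χ.IsQuadratic → χ.IsPrimitive → χ.Odd →
      ∀ σ : ℝ, 0 < σ → σ < 1 → χ.LFunction σ ≠ 0 := by
  interval_cases q
  · -- 1001 ≡ 1 (mod 4): the primitive quadratic character (·/1001) is even (parity test)
    exact good_odd_of_odd (by decide) (by decide) 1 16 32 (by decide +kernel)
  · -- 1002 ≡ 2 (mod 4): no primitive character
    exact fun χ _ hprim _ ↦ (absurd_of_mod_four_two (by decide) hprim).elim
  · exact goodOdd1003 -- certificate
  · -- 1004 = 4·251, 251 ≡ 3 (mod 4): the primitive quadratic character is even (parity test)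
    exact good_odd_of_four (by decide) (by decide) 1 16 32 (by decide +kernel)
  · -- 1005 ≡ 1 (mod 4): the primitive quadratic character (·/1005) is even (parity test)
    exact good_odd_of_odd (by decide) (by decide) 1 16 32 (by decide +kernel)
  · -- 1006 ≡ 2 (mod 4): no primitive character
    exact fun χ _ hprim _ ↦ (absurd_of_mod_four_two (by decide) hprim).elim
  · exact goodOdd1007 -- certificate
  · -- 16 ∣ 1008: no primitive quadratic character
    exact fun χ hquad hprim _ ↦ (absurd_of_sixteen_dvd (by decide) hprim hquad).elim
  · -- 1009 ≡ 1 (mod 4): the primitive quadratic character (·/1009) is even (parity test)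
    exact good_odd_of_odd (by decide) (by decide) 1 16 32 (by decide +kernel)
  · -- 1010 ≡ 2 (mod 4): no primitive character
    exact fun χ _ hprim _ ↦ (absurd_of_mod_four_two (by decide) hprim).elim
  · exact goodOdd1011 -- certificate
  · exact noRealZeroOdd_modulus_1012 -- separate file
  · -- 1013 ≡ 1 (mod 4): the primitive quadratic character (·/1013) is even (parity test)
    exact good_odd_of_odd (by decide) (by decide) 1 16 32 (by decide +kernel)
  · -- 1014 ≡ 2 (mod 4): no primitive character
    exact fun χ _ hprim _ ↦ (absurd_of_mod_four_two (by decide) hprim).elim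
  · exact goodOdd1015 -- certificate
  · exact goodOdd1016 -- certificate
  · -- 3² ∣ 1017: no primitive quadratic character
    exact fun χ hquad hprim _ ↦
      (absurd_of_sq_dvd (p := 3) (by norm_num) (by decide) (by decide) hprim hquad).elim
  · -- 1018 ≡ 2 (mod 4): no primitive character
    exact fun χ _ hprim _ ↦ (absurd_of_mod_four_two (by decide) hprim).elim
  · exact goodOdd1019 -- certificate
  · -- 1020 = 4·255, 255 ≡ 3 (mod 4): the primitive quadratic character is even (parity test)
    exact good_odd_of_four (by decide) (by decide) 1 16 32 (by decide +kernel)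
  · -- 1021 ≡ 1 (mod 4): the primitive quadratic character (·/1021) is even (parity test)
    exact good_odd_of_odd (by decide) (by decide) 1 16 32 (by decide +kernel)
  · -- 1022 ≡ 2 (mod 4): no primitive character
    exact fun χ _ hprim _ ↦ (absurd_of_mod_four_two (by decide) hprim).elim
  · exact goodOdd1023 -- certificate
  · -- 16 ∣ 1024: no primitive quadratic character
    exact fun χ hquad hprim _ ↦ (absurd_of_sixteen_dvd (by decide) hprim hquad).elim
  · -- 5² ∣ 1025: no primitive quadratic character
    exact fun χ hquad hprim _ ↦
      (absurd_of_sq_dvd (p := 5) (by norm_num) (by decide) (by decide) hprim hquad).elim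
  · -- 1026 ≡ 2 (mod 4): no primitive character
    exact fun χ _ hprim _ ↦ (absurd_of_mod_four_two (by decide) hprim).elim
  · exact goodOdd1027 -- certificate
  · exact goodOdd1028 -- certificate
  · -- 7² ∣ 1029: no primitive quadratic character
    exact fun χ hquad hprim _ ↦
      (absurd_of_sq_dvd (p := 7) (by norm_num) (by decide) (by decide) hprim hquad).elim
  · -- 1030 ≡ 2 (mod 4): no primitive character
    exact fun χ _ hprim _ ↦ (absurd_of_mod_four_two (by decide) hprim).elim
  · exact goodOdd1031 -- certificate
  · exact goodOdd1032 -- certificate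
  · -- 1033 ≡ 1 (mod 4): the primitive quadratic character (·/1033) is even (parity test)
    exact good_odd_of_odd (by decide) (by decide) 1 16 32 (by decide +kernel)
  · -- 1034 ≡ 2 (mod 4): no primitive character
    exact fun χ _ hprim _ ↦ (absurd_of_mod_four_two (by decide) hprim).elim
  · -- 3² ∣ 1035: no primitive quadratic character
    exact fun χ hquad hprim _ ↦
      (absurd_of_sq_dvd (p := 3) (by norm_num) (by decide) (by decide) hprim hquad).elim
  · -- 1036 = 4·259, 259 ≡ 3 (mod 4): the primitive quadratic character is even (parity test)
    exact good_odd_of_four (by decide) (by decide) 1 16 32 (by decide +kernel)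
  · -- 1037 ≡ 1 (mod 4): the primitive quadratic character (·/1037) is even (parity test)
    exact good_odd_of_odd (by decide) (by decide) 1 16 32 (by decide +kernel)
  · -- 1038 ≡ 2 (mod 4): no primitive character
    exact fun χ _ hprim _ ↦ (absurd_of_mod_four_two (by decide) hprim).elim
  · exact goodOdd1039 -- certificate
  · -- 16 ∣ 1040: no primitive quadratic character
    exact fun χ hquad hprim _ ↦ (absurd_of_sixteen_dvd (by decide) hprim hquad).elim
  · -- 1041 ≡ 1 (mod 4): the primitive quadratic character (·/1041) is even (parity test)
    exact good_odd_of_odd (by decide) (by decide) 1 16 32 (by decide +kernel)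
  · -- 1042 ≡ 2 (mod 4): no primitive character
    exact fun χ _ hprim _ ↦ (absurd_of_mod_four_two (by decide) hprim).elim
  · exact goodOdd1043 -- certificate
  · -- 3² ∣ 1044: no primitive quadratic character
    exact fun χ hquad hprim _ ↦
      (absurd_of_sq_dvd (p := 3) (by norm_num) (by decide) (by decide) hprim hquad).elim
  · -- 1045 ≡ 1 (mod 4): the primitive quadratic character (·/1045) is even (parity test)
    exact good_odd_of_odd (by decide) (by decide) 1 16 32 (by decide +kernel)
  · -- 1046 ≡ 2 (mod 4): no primitive character
    exact fun χ _ hprim _ ↦ (absurd_of_mod_four_two (by decide) hprim).elim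
  · exact goodOdd1047 -- certificate
  · exact goodOdd1048 -- certificate
  · -- 1049 ≡ 1 (mod 4): the primitive quadratic character (·/1049) is even (parity test)
    exact good_odd_of_odd (by decide) (by decide) 1 16 32 (by decide +kernel)
  · -- 1050 ≡ 2 (mod 4): no primitive character
    exact fun χ _ hprim _ ↦ (absurd_of_mod_four_two (by decide) hprim).elim

end OddTruncationVa

open OddTruncationVa in
/-- **Odd real primitive characters of conductor `1001 ≤ q ≤ 1050` have no real zero in `(0, 1)`.**
[cite: Watkins2004RealZeros, main theorem (d ≤ 3·10⁸, here re-proved in the kernel for this range)] -/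
theorem noRealZeroOdd_range_1001_1050 (q : ℕ) [NeZero q] (hlo : 1000 < q) (hhi : q ≤ 1050) :
    ∀ χ : DirichletCharacter ℂ q, χ.IsQuadratic → χ.IsPrimitive → χ.Odd →
      ∀ σ : ℝ, 0 < σ → σ < 1 → χ.LFunction σ ≠ 0 :=
  range_1001_1050 q hlo hhi

end Literature.NumberTheory.LFunctions
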